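import Summits.AtomisticToContinuum.Crystallization.Theorems.OverbindingBudgetAffineRunCutSheetWalkA

/-!
# `OverbindingBudget` / crux `RobustDefectLimitWindows` (stmt-AtomisticToContinuum-31280) — «RunCut»: SHEET WALKS, part B (the chart-level record)

Support file (lens-4 g88, part 20B; memo `g88/memo/UNIAX-g88.md` §3 (W1), order (2c), radius ruling r1587 (A): ρ₁ = 30).  Part A proved the
one-step kinematics of a basal bond and the abstract walk induction; this file instantiates them on a BASAL CHAIN WITH hcp CHARTS
`(c t, Q_t, A_t, f_t)_{t ≤ K}`, `c (t+1) = f_t (u_t)` for basal `u_t`, `K ≤ 60`: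

* `sheet_walk_record` — ★★ for every `t ≤ K`: (i) linear scale window `|ν_t − ν_0| ≤ (0.0026 + 3·10⁻⁴ t) ν_0`; (ii) axis transport
  `‖ν_t A_t a − σ ν_0 A_0 a‖ ≤ 4.1·10⁻⁴ t ν_0` for a sign `σ`; (iii) height over the start plane `|⟪ν_0 A_0 a, y (c t) − y (c 0)⟫| ≤
  (2.1·10⁻⁴ t² + 4·10⁻³ t) ν_0²` (`a = (4,4,4)/√18`, `ν_t = nearestDist y (c t)`);
* `sheet_walk_height` — (iii) in units of length: `|⟪‖A_0 a‖⁻¹ • A_0 a, y (c t) − y (c 0)⟫| ≤ (1.3·10⁻⁴ t² + 2.5·10⁻³ t) ν_0`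
  (`t = 13`: `0.055 ν_0` — the local flatness `ε = 1/10` of `…CrossCore.crossing_numbers_record`; `t = 45`: `0.38 ν_0` — the vertical
  arrival accuracy of the access walks of part 22);
* `sheet_walk_step` — the per-step facts the endgame consumes, for every `t < K`: `c (t+1) ≠ c t`, `dist ≤ 1.0011 ν_t`, `dist ≤ 1.0011 ν_{t+1}`,
  and the unit tilt `|⟪‖A_t a‖⁻¹ • A_t a, y (c (t+1)) − y (c t)⟫| ≤ (1/400)·dist` (the `μ = 1/400` of `…CrossCore.abs_inner_le_of_tilt`);
* `norm_unit_sub_unit_le` (`‖û − v̂‖ ≤ ‖u − v‖/m`), `unit_smul_of_pos`, `unit_sign_smul`, and `sheet_walk_axis_unit` — ★ (ii) in unit form: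
  `‖N_t − σ N_0‖ ≤ 2.6·10⁻⁴ t` for the local unit axes `N_t = ‖A_t a‖⁻¹ • A_t a` (the drift the tilt floor `c₀ = 7/25` absorbs).
[this file: 0 definitions, 7 theorems; imports the staged part 20A `…RunCutSheetWalkA`; standard axioms]
-/

namespace Summit.AtomisticToContinuum.Crystallization.Theorems.OverbindingBudgetAffineRunCutSheetWalk

open scoped InnerProductSpace
open Literature.Geometry.DiscreteGeometry
open Summit.AtomisticToContinuum.Crystallization.Theorems.OverbindingBudgetAffineRunCutSheetLetterA
open Summit.AtomisticToContinuum.Crystallization.Theorems.OverbindingBudgetAffineRunCutSheetLetter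
open Summit.AtomisticToContinuum.Crystallization.Theorems.OverbindingBudgetAffineRunCutSheetWalkA
open Summit.AtomisticToContinuum.Crystallization.Theorems.OverbindingBudgetAffineCompressedCutEstablish (nearestDist_pos_of_frame)

variable {N : ℕ}

local notation "E3" => EuclideanSpace ℝ (Fin 3)

section Chain

/-! A basal chain with hcp charts: sites `c t`, charts `(Q t, A t, f t)` for `t ≤ K`, basal steps `u t` for `t < K`. -/
variable {y : Fin N → E3} (hy : Function.Injective y) (c : ℕ → Fin N)
  (Q : ℕ → (E3 →ₗᵢ[ℝ] E3)) (A : ℕ → (E3 →ₗ[ℝ] E3)) (f : ℕ → E3 → E3) (u : ℕ → E3) {K : ℕ} (hK : K ≤ 60)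
  (hA : ∀ t, t ≤ K → ∀ v ∈ hcpTwoShellPattern, ‖A t v - Q t v‖ ≤ 1 / 1000)
  (hf : ∀ t, t ≤ K → ∀ v ∈ hcpTwoShellPattern,
    f t v ∈ Set.range y ∧ dist (f t v) (y (c t) + nearestDist y (c t) • A t v) ≤ 1 / 10 ^ 4 * nearestDist y (c t))
  (hinj : ∀ t, t ≤ K → Set.InjOn (f t) ↑hcpTwoShellPattern)
  (hex : ∀ t, t ≤ K → ∀ k : Fin N, k ≠ c t → dist (y k) (y (c t)) ≤ (3 / 2 + 1 / 450) * nearestDist y (c t) →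
    ∃ v ∈ hcpTwoShellPattern, f t v = y k)
  (hu : ∀ t, t < K → u t ∈ hcpTwoShellPattern ∧ u t 0 + u t 1 + u t 2 = 0 ∧ f t (u t) = y (c (t + 1)))

include hy hK hA hf hinj hex hu

/-- ★★ **THE SHEET-WALK RECORD.**  Along a basal chain with hcp charts (`K ≤ 60` steps), for every `t ≤ K`: (i) `|ν_t − ν_0| ≤ (0.0026 + 3·10⁻⁴t)ν_0`;
(ii) `‖ν_t A_t a − σ ν_0 A_0 a‖ ≤ 4.1·10⁻⁴ t ν_0` for a sign `σ`; (iii) `|⟪ν_0 A_0 a, y (c t) − y (c 0)⟫| ≤ (2.1·10⁻⁴ t² + 4·10⁻³ t) ν_0²`.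
(The per-step inputs are `…SheetLetter.basal_step_record` (C)(D) and `…SheetWalkA.basal_step_kinematics`; the induction is
`…SheetWalkA.walk_induction`.) [this file · kind: proof] -/
theorem sheet_walk_record : ∀ t, t ≤ K →
    |nearestDist y (c t) - nearestDist y (c 0)| ≤ (26 / 10000 + 3 / 10000 * t) * nearestDist y (c 0) ∧
    (∃ σ : ℝ, (σ = 1 ∨ σ = -1) ∧
      ‖nearestDist y (c t) • A t ((Real.sqrt 18)⁻¹ • intVec ![4, 4, 4]) - σ • (nearestDist y (c 0) • A 0 ((Real.sqrt 18)⁻¹ • intVec ![4, 4, 4]))‖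
        ≤ 41 / 100000 * t * nearestDist y (c 0)) ∧
    |⟪nearestDist y (c 0) • A 0 ((Real.sqrt 18)⁻¹ • intVec ![4, 4, 4]), y (c t) - y (c 0)⟫_ℝ|
      ≤ (21 / 100000 * t ^ 2 + 4 / 1000 * t) * nearestDist y (c 0) ^ 2 := by
  set a : E3 := (Real.sqrt 18)⁻¹ • intVec ![4, 4, 4] with hadef
  have hν0 : 0 < nearestDist y (c 0) := nearestDist_pos_of_frame hy (Or.inr rfl) (fun v hv => (hf 0 (Nat.zero_le K) v hv).1) (hinj 0 (Nat.zero_le K))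
  -- the record and the kinematics at each step `t < K`
  have hrec := fun t (ht : t < K) =>
    basal_step_record hy (hA t ht.le) (hf t ht.le) (hinj t ht.le) (hex t ht.le) (P' := hcpTwoShellPattern) (Or.inr rfl)
      (hA (t + 1) ht) (hf (t + 1) ht) (hinj (t + 1) ht) (hex (t + 1) ht) (hu t ht).1 (hu t ht).2.1 (hu t ht).2.2
  have hkin := fun t (ht : t < K) =>
    basal_step_kinematics hy (hA t ht.le) (hf t ht.le) (hinj t ht.le) (hex t ht.le) (P' := hcpTwoShellPattern) (Or.inr rfl)
      (hA (t + 1) ht) (hf (t + 1) ht) (hinj (t + 1) ht) (hex (t + 1) ht) (hu t ht).1 (hu t ht).2.1 (hu t ht).2.2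
  refine walk_induction (fun t => nearestDist y (c t) • A t a) (fun t => y (c t)) (fun t => nearestDist y (c t)) K hK hν0
    ?_ ?_ ?_ ?_ ?_
  · intro t ht; exact (hrec t ht).2.2.1
  · intro t ht
    have := (hrec t ht).2.2.2.2.2.2; norm_num at this ⊢; linarith
  · intro t ht
    have hνt : 0 ≤ nearestDist y (c t) := nearestDist_nonneg y (c t)
    obtain ⟨hL, hU⟩ := frame_axis_norm (frame_axis_close (hA t ht))
    simp only [norm_smul, Real.norm_of_nonneg hνt]
    exact ⟨by nlinarith, by nlinarith⟩
  · intro t ht; exact (hkin t ht).2.2.1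
  · intro t ht; exact (hkin t ht).2.2.2.2.1

/-- (iii) **in units of length**: `|⟪‖A_0 a‖⁻¹ • A_0 a, y (c t) − y (c 0)⟫| ≤ (1.3·10⁻⁴ t² + 2.5·10⁻³ t) ν_0`. [this file · kind: proof] -/
theorem sheet_walk_height : ∀ t, t ≤ K →
    |⟪(‖A 0 ((Real.sqrt 18)⁻¹ • intVec ![4, 4, 4])‖⁻¹ • A 0 ((Real.sqrt 18)⁻¹ • intVec ![4, 4, 4]) : E3), y (c t) - y (c 0)⟫_ℝ|
      ≤ (13 / 100000 * t ^ 2 + 25 / 10000 * t) * nearestDist y (c 0) := by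
  intro t ht
  set a : E3 := (Real.sqrt 18)⁻¹ • intVec ![4, 4, 4] with hadef
  have hν0 : 0 < nearestDist y (c 0) := nearestDist_pos_of_frame hy (Or.inr rfl) (fun v hv => (hf 0 (Nat.zero_le K) v hv).1) (hinj 0 (Nat.zero_le K))
  obtain ⟨-, -, hiii⟩ := sheet_walk_record hy c Q A f u hK hA hf hinj hex hu t ht
  obtain ⟨hL, -⟩ := frame_axis_norm (frame_axis_close (hA 0 (Nat.zero_le K)))
  rw [← hadef] at hL hiii
  have hApos : 0 < ‖A 0 a‖ := by linarith
  have ht0 : (0 : ℝ) ≤ t := by exact_mod_cast Nat.zero_le t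
  rw [real_inner_smul_left, abs_mul, abs_of_pos (inv_pos.2 hApos)]
  rw [real_inner_smul_left, abs_mul, abs_of_pos hν0] at hiii
  -- `ν_0 · |⟪A_0 a, ·⟫| ≤ (…) ν_0²` ⇒ `|⟪A_0 a, ·⟫| ≤ (…) ν_0`; divide by `‖A_0 a‖ ≥ 1.6309`
  have h1 : |⟪A 0 a, y (c t) - y (c 0)⟫_ℝ| ≤ (21 / 100000 * t ^ 2 + 4 / 1000 * t) * nearestDist y (c 0) := by
    have := hiii; nlinarith [abs_nonneg ⟪A 0 a, y (c t) - y (c 0)⟫_ℝ]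
  rw [inv_mul_le_iff₀ hApos]
  have hnn : 0 ≤ (13 / 100000 * (t : ℝ) ^ 2 + 25 / 10000 * t) * nearestDist y (c 0) := by positivity
  have h2 := mul_le_mul_of_nonneg_right hL hnn
  nlinarith [h1, h2, mul_nonneg (sq_nonneg (t : ℝ)) hν0.le, mul_nonneg ht0 hν0.le]

omit hK in
/-- ★ **The per-step facts the endgame consumes** (`t < K`): `c (t+1) ≠ c t`; the bond is `≤ 1.0011×` the scale of EITHER endpoint; and its
unit tilt against the local axis is `≤ 1/400` of its length. [this file · kind: proof] -/
theorem sheet_walk_step : ∀ t, t < K →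
    c (t + 1) ≠ c t ∧
    dist (y (c t)) (y (c (t + 1))) ≤ 10011 / 10000 * nearestDist y (c t) ∧
    dist (y (c t)) (y (c (t + 1))) ≤ 10011 / 10000 * nearestDist y (c (t + 1)) ∧
    |⟪(‖A t ((Real.sqrt 18)⁻¹ • intVec ![4, 4, 4])‖⁻¹ • A t ((Real.sqrt 18)⁻¹ • intVec ![4, 4, 4]) : E3), y (c (t + 1)) - y (c t)⟫_ℝ|
      ≤ 1 / 400 * dist (y (c t)) (y (c (t + 1))) := by
  intro t ht
  set a : E3 := (Real.sqrt 18)⁻¹ • intVec ![4, 4, 4] with hadef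
  obtain ⟨-, K2L, K2U, K3, K4, K6⟩ :=
    basal_step_kinematics hy (hA t ht.le) (hf t ht.le) (hinj t ht.le) (hex t ht.le) (P' := hcpTwoShellPattern) (Or.inr rfl)
      (hA (t + 1) ht) (hf (t + 1) ht) (hinj (t + 1) ht) (hex (t + 1) ht) (hu t ht).1 (hu t ht).2.1 (hu t ht).2.2
  rw [← hadef] at K4
  have hνt : 0 < nearestDist y (c t) :=
    nearestDist_pos_of_frame hy (Or.inr rfl) (fun v hv => (hf t ht.le v hv).1) (hinj t ht.le)
  obtain ⟨hL, -⟩ := frame_axis_norm (frame_axis_close (hA t ht.le))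
  rw [← hadef] at hL
  have hApos : 0 < ‖A t a‖ := by linarith
  rw [dist_eq_norm, norm_sub_rev]
  refine ⟨K6, K2U, K3, ?_⟩
  rw [real_inner_smul_left, abs_mul, abs_of_pos (inv_pos.2 hApos), inv_mul_le_iff₀ hApos]
  rw [real_inner_smul_left, abs_mul, abs_of_pos hνt] at K4
  -- `ν |⟪A a, s⟫| ≤ 0.0038 ν²` ⇒ `|⟪A a, s⟫| ≤ 0.0038 ν ≤ 0.0038/0.9989 ‖s‖ ≤ ‖A a‖/400 · ‖s‖`
  have h1 : |⟪A t a, y (c (t + 1)) - y (c t)⟫_ℝ| ≤ 38 / 10000 * nearestDist y (c t) := by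
    nlinarith [K4, abs_nonneg ⟪A t a, y (c (t + 1)) - y (c t)⟫_ℝ]
  have h2 := mul_le_mul hL K2L (by positivity) (norm_nonneg _)
  nlinarith [h1, h2, hνt.le]

/-! ## Unit axes (the tilt floor `c₀` of the endgame compares UNIT axes) -/

omit hy hK hA hf hinj hex hu in
/-- **Unit vectors of nearby vectors are nearby**, SHARP form: `‖u/‖u‖ − v/‖v‖‖ ≤ ‖u − v‖ / m` when `m ≤ ‖u‖, ‖v‖` (from
`‖u/‖u‖ − v/‖v‖‖²·‖u‖‖v‖ = 2‖u‖‖v‖ − 2⟪u,v⟫ ≤ ‖u − v‖²`).  The tree's factor-2 form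
`Literature.Geometry.Riemannian.MeanConvexHelpTerm.norm_normalize_sub_normalize_le` is not enough here:
the tilt-floor budget of the endgame cannot afford the `2` (`2 × 0.025 > 1/3 − 1/100 − 7/25`). [this file · kind: glue] -/
theorem norm_unit_sub_unit_le {u v : E3} {m : ℝ} (hm : 0 < m) (hu : m ≤ ‖u‖) (hv : m ≤ ‖v‖) :
    ‖(‖u‖⁻¹ • u : E3) - ‖v‖⁻¹ • v‖ ≤ ‖u - v‖ / m := by
  have hu0 : 0 < ‖u‖ := hm.trans_le hu
  have hv0 : 0 < ‖v‖ := hm.trans_le hv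
  have hun : ‖(‖u‖⁻¹ • u : E3)‖ = 1 := by rw [norm_smul, norm_inv, norm_norm, inv_mul_cancel₀ hu0.ne']
  have hvn : ‖(‖v‖⁻¹ • v : E3)‖ = 1 := by rw [norm_smul, norm_inv, norm_norm, inv_mul_cancel₀ hv0.ne']
  have e1 : ‖(‖u‖⁻¹ • u : E3) - ‖v‖⁻¹ • v‖ ^ 2 = 2 - 2 * (‖u‖⁻¹ * (‖v‖⁻¹ * ⟪u, v⟫_ℝ)) := by
    rw [norm_sub_sq_real, real_inner_smul_left, real_inner_smul_right, hun, hvn]; ring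
  have e2 : ‖u - v‖ ^ 2 = ‖u‖ ^ 2 - 2 * ⟪u, v⟫_ℝ + ‖v‖ ^ 2 := norm_sub_sq_real u v
  have key : ‖(‖u‖⁻¹ • u : E3) - ‖v‖⁻¹ • v‖ ^ 2 * (‖u‖ * ‖v‖) ≤ ‖u - v‖ ^ 2 := by
    have e3 : ‖(‖u‖⁻¹ • u : E3) - ‖v‖⁻¹ • v‖ ^ 2 * (‖u‖ * ‖v‖) = 2 * (‖u‖ * ‖v‖) - 2 * ⟪u, v⟫_ℝ := by
      rw [e1]; field_simp
    rw [e3, e2]; nlinarith [sq_nonneg (‖u‖ - ‖v‖)]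
  have hmm : m * m ≤ ‖u‖ * ‖v‖ := mul_le_mul hu hv hm.le hu0.le
  have hsq : (‖(‖u‖⁻¹ • u : E3) - ‖v‖⁻¹ • v‖ * m) ^ 2 ≤ ‖u - v‖ ^ 2 := by
    rw [mul_pow]; nlinarith [key, hmm, sq_nonneg ‖(‖u‖⁻¹ • u : E3) - ‖v‖⁻¹ • v‖]
  rw [le_div_iff₀ hm]
  exact (pow_le_pow_iff_left₀ (by positivity) (norm_nonneg _) two_ne_zero).1 hsq

omit hy hK hA hf hinj hex hu in
/-- Positive rescaling does not change the unit vector. [this file · kind: glue] -/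
theorem unit_smul_of_pos {w : E3} {ν : ℝ} (hν : 0 < ν) : (‖ν • w‖⁻¹ • (ν • w) : E3) = ‖w‖⁻¹ • w := by
  by_cases hw : w = 0
  · simp [hw]
  · have hw' : ‖w‖ ≠ 0 := norm_ne_zero_iff.2 hw
    rw [norm_smul, Real.norm_of_nonneg hν.le, smul_smul]
    congr 1
    field_simp

omit hy hK hA hf hinj hex hu in
/-- A sign passes through normalisation. [this file · kind: glue] -/
theorem unit_sign_smul {w : E3} {σ : ℝ} (hσ : σ = 1 ∨ σ = -1) : (‖σ • w‖⁻¹ • (σ • w) : E3) = σ • (‖w‖⁻¹ • w) := by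
  rcases hσ with h | h
  · subst h; simp
  · subst h; simp [norm_neg, smul_comm]

/-- ★ **AXIS TRANSPORT IN UNIT FORM**: along the chain the local unit axes `N_t = ‖A_t a‖⁻¹ • A_t a` satisfy `‖N_t − σ N_0‖ ≤ 2.6·10⁻⁴ · t` for a
sign `σ` (`t ≤ K ≤ 60`; over the `≤ 95` steps of the two access walks of part 22 this is `≤ 0.025`, inside the tilt-floor budget
`1/3 − 1/100 − 7/25 = 0.043` of `…CrossCore.crossing_numbers_record`). [this file · kind: proof] -/
theorem sheet_walk_axis_unit : ∀ t, t ≤ K → ∃ σ : ℝ, (σ = 1 ∨ σ = -1) ∧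
    ‖(‖A t ((Real.sqrt 18)⁻¹ • intVec ![4, 4, 4])‖⁻¹ • A t ((Real.sqrt 18)⁻¹ • intVec ![4, 4, 4]) : E3)
      - σ • (‖A 0 ((Real.sqrt 18)⁻¹ • intVec ![4, 4, 4])‖⁻¹ • A 0 ((Real.sqrt 18)⁻¹ • intVec ![4, 4, 4]))‖ ≤ 26 / 100000 * t := by
  intro t ht
  set a : E3 := (Real.sqrt 18)⁻¹ • intVec ![4, 4, 4] with hadef
  have hν0 : 0 < nearestDist y (c 0) := nearestDist_pos_of_frame hy (Or.inr rfl) (fun v hv => (hf 0 (Nat.zero_le K) v hv).1) (hinj 0 (Nat.zero_le K))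
  have hνt : 0 < nearestDist y (c t) := nearestDist_pos_of_frame hy (Or.inr rfl) (fun v hv => (hf t ht v hv).1) (hinj t ht)
  obtain ⟨hi, ⟨σ, hσ, hii⟩, -⟩ := sheet_walk_record hy c Q A f u hK hA hf hinj hex hu t ht
  rw [← hadef] at hii
  obtain ⟨hL0, -⟩ := frame_axis_norm (frame_axis_close (hA 0 (Nat.zero_le K)))
  obtain ⟨hLt, -⟩ := frame_axis_norm (frame_axis_close (hA t ht))
  rw [← hadef] at hL0 hLt
  have ht60 : (t : ℝ) ≤ 60 := by exact_mod_cast ht.trans hK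
  have ht0 : (0 : ℝ) ≤ t := by exact_mod_cast Nat.zero_le t
  rw [abs_le] at hi
  -- both transported vectors have norm `≥ 1.59 ν_0`
  set m : ℝ := 159 / 100 * nearestDist y (c 0) with hmdef
  have hm : 0 < m := by positivity
  have hνlow : 9794 / 10000 * nearestDist y (c 0) ≤ nearestDist y (c t) := by
    nlinarith [hi.1, mul_le_mul_of_nonneg_right ht60 hν0.le]
  have hu' : m ≤ ‖nearestDist y (c t) • A t a‖ := by
    rw [norm_smul, Real.norm_of_nonneg hνt.le]
    have h := mul_le_mul hνlow hLt (by norm_num) hνt.le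
    nlinarith [h, hν0.le]
  have hv' : m ≤ ‖σ • (nearestDist y (c 0) • A 0 a)‖ := by
    rw [norm_sign_smul hσ, norm_smul, Real.norm_of_nonneg hν0.le]
    have h := mul_le_mul_of_nonneg_left hL0 hν0.le
    nlinarith [h, hν0.le]
  have key := norm_unit_sub_unit_le hm hu' hv'
  rw [unit_smul_of_pos hνt, unit_sign_smul hσ, unit_smul_of_pos hν0] at key
  refine ⟨σ, hσ, key.trans ?_⟩
  rw [div_le_iff₀ hm, hmdef]
  nlinarith [hii, hν0.le, ht0]

end Chain

end Summit.AtomisticToContinuum.Crystallization.Theorems.OverbindingBudgetAffineRunCutSheetWalk
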